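import Summits.QuantumFields.YangMills.Theorems.UnitScaleTiltProp8ChartHInvSmoothTentProfile
import HarnessLib

/-!
# Route `UnitScaleTilt`, crux K1 «MinimiserStabilityRegPr» (stmt-QuantumFields-19200), leaf V2′ — the P2→P3 BRIDGE (hH of `ChartRemainderAt`),
# part B3b: **SMOOTH BUMPS ON THE `j`-FOLD BLOCKS WITH FIRST AND SECOND DIFFERENCE BOUNDS** (WANTED №g26-1 row (X3): the (46) GRADIENT row of the
# chart-H `H X = H₀X̃′ + dφ`; sequel of `…ChartHInvSmoothTentProfile`; ★★OWNER g26 ASSIGNMENTS 9 (a) 05:01:42Z: «the C¹-flat zero extension is the cleaner bump, ADOPTED as the bump of record»)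

Cell `ym3-torus` (HUMAN RULING D-0037: YM ladder rung R3 — SU(2) YM₃ on the torus is a RUNG, not the Clay problem), width seat `ym-ust-19200-w3` gen 4;
`--supports stmt-QuantumFields-19200 --as helper`; def-free, 0 sorry.

THE BUMP of the block `B^j(y)` is the PRODUCT over the coordinates `τ(x) = Π_α h_α(x_α)`, `h_α(v) = [v.val / N = y_α]·g(v.val mod N)` with the quartic profile `g`
of `…ChartHInvSmoothTentProfile` (`N = L^j = 2c+1`) — each factor a function of ONE torus coordinate — so that `Δ_νΔ_μτ = (Δh_μ)(Δh_ν)·Π_{α ≠ μ,ν} h_α` for `μ ≠ ν` and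
`Δ_μΔ_μτ = (Δ²h_μ)·Π_{α ≠ μ} h_α`; on the torus coordinate (`2L^{m+K}` labels, a multiple of `N`) the wrap-around only meets labels `0, 1, N−2, N−1`, where every
value is `≤ 16/(c+1)²`.

WHAT IS PROVED (theorems only; no definition): §3 the torus coordinate (`bumpZ_*`: `|Δh| ≤ 4/(c+1)`, `|Δ²h| ≤ 64/(c+1)²`); §4 products over the coordinates under
one-coordinate shifts (`prod_coord_shift_sub`, `prod_coord_shift_shift_mixed`, `prod_coord_shift_shift_pure`); §5 **`exists_smoothTent`**: for `j ≤ m + K` and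
`y ∈ T^{(j)}` a `τ : T_η → [0, 1]` with `τ(embIter j y) = 1`, `τ = 0` off `B^j(y)`, `|τ(b₊) − τ(b₋)| ≤ 8/L^j` on every fine bond, and
`|τ(x + e_ν + e_μ) − τ(x + e_ν) − τ(x + e_μ) + τ(x)| ≤ 256/(L^j)²` for all `x, μ, ν` — the input of the gradient letter of the bridge.  Only the VALUES
`τ(embIter j y) = 1` and the support enter the right-inverse identity `ChartHInvBridge.main_identity`, so the bridge's algebra is untouched when the linear
tents of `exists_tent` are replaced by these bumps.  NOT a claim about Bałaban's estimates, the stub, the crux, the rung or the mass gap.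

References: T. Bałaban, CMP **102** (1985) 277–309 [Balaban1985Variational] ((46) p.285); CMP **96** (1984) 223–250 [Balaban1984PropagatorsII] ((2.2)–(2.4) p.224,
(2.147) p.248); CMP **109** (1987) 249–301 [Balaban1987RG1] ((0.1) p.251).
-/

set_option autoImplicit false

noncomputable section

open scoped BigOperators

namespace Summit.QuantumFields.YangMills.Theorems.ChartHInv

open Literature.MathematicalPhysics.QuantumFieldTheory.Balaban1983to89
open T4Continuum
open B5Eq118OneStroke (iterBlockOf val_iterBlockOf)
open B15DeterminingSets (embIter)
open B10StarCount (shift_apply_self shift_apply_ne)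
open Literature.MathematicalPhysics.QuantumFieldTheory.BalabanImbrieJaffe1984to88.BIJ88RT51Background (iterBlockOf_embIter)
open Literature.MathematicalPhysics.QuantumFieldTheory.BalabanImbrieJaffe1984to88 (BIJ88BlockCentredWeight.pow_dvd_sitesPerDir)

variable {P : Params}

/-! ## §3 The torus coordinate: `h(v) = G(v.val)` on `ZMod (2L^{m+K})` (a multiple of `N`, at least two labels) -/

section Torus

/-- `(S − 1) mod N = N − 1` when `N ∣ S`, `0 < S`. [folklore] -/
theorem pred_mod_of_dvd {N S : ℕ} (hN : 0 < N) (hS : 0 < S) (hNS : N ∣ S) : (S - 1) % N = N - 1 := by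
  obtain ⟨B, hB⟩ := hNS
  have hB1 : 1 ≤ B := by
    rcases Nat.eq_zero_or_pos B with h | h
    · rw [h, mul_zero] at hB; omega
    · exact h
  have h1 : N * B = N * (B - 1) + N := by rw [← Nat.mul_succ]; congr 1; omega
  have : S - 1 = N * (B - 1) + (N - 1) := by omega
  rw [this, Nat.mul_add_mod, Nat.mod_eq_of_lt (by omega)]

/-- `N − 2 ≤ (S − 2) mod N` when `N ∣ S`, `2 ≤ S` (equality for `N ≥ 2`). [folklore] -/
theorem sub_two_le_sub_two_mod_of_dvd {N S : ℕ} (hN : 0 < N) (hS : 2 ≤ S) (hNS : N ∣ S) : N - 2 ≤ (S - 2) % N := by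
  rcases Nat.lt_or_ge N 3 with h3 | h3
  · omega
  · obtain ⟨B, hB⟩ := hNS
    have hB1 : 1 ≤ B := by
      rcases Nat.eq_zero_or_pos B with h | h
      · rw [h, mul_zero] at hB; omega
      · exact h
    have h1 : N * B = N * (B - 1) + N := by rw [← Nat.mul_succ]; congr 1; omega
    have : S - 2 = N * (B - 1) + (N - 2) := by omega
    rw [this, Nat.mul_add_mod, Nat.mod_eq_of_lt (by omega)]

variable {N c : ℕ} (hN : N = 2 * c + 1) (g : ℝ → ℝ) (hg : ∀ t, g t = ((t + 1) * ((N : ℝ) - t)) ^ 2 / ((c : ℝ) + 1) ^ 4)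
  (a : ℕ) (G : ℕ → ℝ) (hG : ∀ w, G w = if w / N = a then g ((w % N : ℕ) : ℝ) else 0)
  (hNS : N ∣ P.sitesPerDir 0) (h : ZMod (P.sitesPerDir 0) → ℝ) (hh : ∀ v, h v = G v.val)

/-- The label of `v + 1` on the torus coordinate. [folklore] -/
theorem bumpZ_val_succ (v : ZMod (P.sitesPerDir 0)) : (v + 1).val = (v.val + 1) % P.sitesPerDir 0 := by
  rw [ZMod.val_add, ZMod.val_one]

include hN hg hG hh in
/-- The torus-coordinate factor takes values in `[0, 1]`. [folklore] -/
theorem bumpZ_mem_unit (v : ZMod (P.sitesPerDir 0)) : 0 ≤ h v ∧ h v ≤ 1 := by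
  rw [hh]; exact bumpExt_mem_unit hN g hg a G hG _

include hN hg hG hNS hh in
/-- **FIRST DIFFERENCES ON THE TORUS COORDINATE**: `|h(v+1) − h(v)| ≤ 4/(c+1)` (across the wrap-around both labels are end labels, values `≤ 4/(c+1)²`).
[folklore] -/
theorem bumpZ_diff (v : ZMod (P.sitesPerDir 0)) : |h (v + 1) - h v| ≤ 4 / ((c : ℝ) + 1) := by
  have hS1 : 1 < P.sitesPerDir 0 := Fact.out
  have hNpos : 0 < N := by omega
  rw [hh, hh, bumpZ_val_succ v]
  by_cases hw : v.val + 1 < P.sitesPerDir 0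
  · rw [Nat.mod_eq_of_lt hw]; exact bumpExt_diff hN g hg a G hG _
  · have hv : v.val + 1 = P.sitesPerDir 0 := by have := ZMod.val_lt v; omega
    rw [hv, Nat.mod_self]
    have h0 := bumpExt_ends hN g hg a G hG (w := 0) (Or.inl (Nat.zero_mod N))
    have h1 := bumpExt_ends hN g hg a G hG (w := v.val)
      (Or.inr (by rw [show v.val = P.sitesPerDir 0 - 1 by omega]; exact pred_mod_of_dvd hNpos (by omega) hNS))
    have h0' := (bumpExt_mem_unit hN g hg a G hG 0).1
    have h1' := (bumpExt_mem_unit hN g hg a G hG v.val).1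
    have hc0 : (0 : ℝ) < (c : ℝ) + 1 := by positivity
    have hc1 : (1 : ℝ) ≤ (c : ℝ) + 1 := by have : (0 : ℝ) ≤ c := Nat.cast_nonneg c; linarith
    have hcc : 4 / ((c : ℝ) + 1) ^ 2 ≤ 4 / ((c : ℝ) + 1) :=
      div_le_div_of_nonneg_left (by norm_num) hc0 (by nlinarith)
    rw [abs_le]; constructor <;> linarith

include hN hg hG hNS hh in
/-- **SECOND DIFFERENCES ON THE TORUS COORDINATE**: `|h(v+2) − 2h(v+1) + h(v)| ≤ 64/(c+1)²` (away from the wrap-around by the line lemma; across it the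
three labels are among `N−2, N−1, 0, 1`, values `≤ 16/(c+1)²`). [folklore] -/
theorem bumpZ_diff2 (v : ZMod (P.sitesPerDir 0)) : |h (v + 1 + 1) - 2 * h (v + 1) + h v| ≤ 64 / ((c : ℝ) + 1) ^ 2 := by
  have hS1 : 1 < P.sitesPerDir 0 := Fact.out
  have hNpos : 0 < N := by omega
  have hvlt := ZMod.val_lt v
  rw [hh, hh, hh, bumpZ_val_succ (v + 1), bumpZ_val_succ v]
  by_cases hw : v.val + 2 < P.sitesPerDir 0
  · rw [Nat.mod_eq_of_lt (by omega : v.val + 1 < P.sitesPerDir 0), Nat.mod_eq_of_lt (by omega : v.val + 1 + 1 < P.sitesPerDir 0)]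
    have h32 := bumpExt_diff2 hN g hg a G hG v.val
    have h3264 : 32 / ((c : ℝ) + 1) ^ 2 ≤ 64 / ((c : ℝ) + 1) ^ 2 := div_le_div_of_nonneg_right (by norm_num) (by positivity)
    exact h32.trans h3264
  · -- the wrap-around: every label involved is near a face
    have hsmall : ∀ w : ℕ, (w % N ≤ 1 ∨ N - 2 ≤ w % N) → 0 ≤ G w ∧ G w ≤ 16 / ((c : ℝ) + 1) ^ 2 := fun w hw =>
      ⟨(bumpExt_mem_unit hN g hg a G hG w).1, bumpExt_near_face hN g hg a G hG hw⟩
    have key : ∀ x y z : ℝ, (0 ≤ x ∧ x ≤ 16 / ((c : ℝ) + 1) ^ 2) → (0 ≤ y ∧ y ≤ 16 / ((c : ℝ) + 1) ^ 2) →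
        (0 ≤ z ∧ z ≤ 16 / ((c : ℝ) + 1) ^ 2) → |x - 2 * y + z| ≤ 64 / ((c : ℝ) + 1) ^ 2 := by
      intro x y z hx hy hz
      have h64 : 64 / ((c : ℝ) + 1) ^ 2 = 4 * (16 / ((c : ℝ) + 1) ^ 2) := by ring
      rw [abs_le, h64]; constructor <;> linarith [hx.1, hx.2, hy.1, hy.2, hz.1, hz.2]
    have hlabS1 : N - 2 ≤ (P.sitesPerDir 0 - 1) % N := by rw [pred_mod_of_dvd hNpos (by omega) hNS]; omega
    have hlabS2 : N - 2 ≤ (P.sitesPerDir 0 - 2) % N := sub_two_le_sub_two_mod_of_dvd hNpos (by omega) hNS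
    rcases Nat.lt_or_ge (v.val + 1) (P.sitesPerDir 0) with hlt | hge
    · -- `v.val = S − 2`
      have hv : v.val = P.sitesPerDir 0 - 2 := by omega
      have e1 : (v.val + 1) % P.sitesPerDir 0 = P.sitesPerDir 0 - 1 := by rw [Nat.mod_eq_of_lt hlt]; omega
      have e2 : (P.sitesPerDir 0 - 1 + 1) % P.sitesPerDir 0 = 0 := by
        rw [show P.sitesPerDir 0 - 1 + 1 = P.sitesPerDir 0 by omega, Nat.mod_self]
      rw [e1, e2, hv]
      exact key _ _ _ (hsmall _ (Or.inl (by rw [Nat.zero_mod]; omega))) (hsmall _ (Or.inr hlabS1)) (hsmall _ (Or.inr hlabS2))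
    · -- `v.val = S − 1`
      have hv : v.val = P.sitesPerDir 0 - 1 := by omega
      have e1 : (v.val + 1) % P.sitesPerDir 0 = 0 := by rw [show v.val + 1 = P.sitesPerDir 0 by omega, Nat.mod_self]
      have e2 : (0 + 1) % P.sitesPerDir 0 = 1 := Nat.mod_eq_of_lt (by omega)
      rw [e1, e2, hv]
      exact key _ _ _ (hsmall _ (Or.inl (Nat.mod_le 1 N))) (hsmall _ (Or.inl (by rw [Nat.zero_mod]; omega))) (hsmall _ (Or.inr hlabS1))

end Torus

/-! ## §4 Products over the coordinates under one-coordinate updates -/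

section Prod

variable (F : Fin P.d → ZMod (P.sitesPerDir 0) → ℝ)

/-- Pulling one factor out of a product over the coordinates. [folklore] -/
theorem prod_coord_split {s : Finset (Fin P.d)} {ν : Fin P.d} (hν : ν ∈ s) (z : Site P 0) :
    ∏ α ∈ s, F α (z α) = F ν (z ν) * ∏ α ∈ s.erase ν, F α (z α) :=
  (Finset.mul_prod_erase s (fun α => F α (z α)) hν).symm

/-- A product over coordinates all different from `ν` does not see the shift by `e_ν`. [folklore] -/
theorem prod_coord_congr {s : Finset (Fin P.d)} (z x : Site P 0) (hzx : ∀ α ∈ s, z α = x α) :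
    ∏ α ∈ s, F α (z α) = ∏ α ∈ s, F α (x α) :=
  Finset.prod_congr rfl fun α hα => by rw [hzx α hα]

/-- **FIRST DIFFERENCE OF A COORDINATE PRODUCT**: `Π_α F_α((x+e_ν)_α) − Π_α F_α(x_α) = (F_ν(x_ν+1) − F_ν(x_ν))·Π_{α ≠ ν} F_α(x_α)`. [folklore] -/
theorem prod_coord_shift_sub (x : Site P 0) (ν : Fin P.d) :
    (∏ α, F α ((x.shift ν) α)) - ∏ α, F α (x α) = (F ν (x ν + 1) - F ν (x ν)) * ∏ α ∈ Finset.univ.erase ν, F α (x α) := by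
  rw [prod_coord_split F (Finset.mem_univ ν) (x.shift ν), prod_coord_split F (Finset.mem_univ ν) x, shift_apply_self,
    prod_coord_congr F (x.shift ν) x fun α hα => shift_apply_ne x (Finset.ne_of_mem_erase hα)]
  ring

/-- **MIXED SECOND DIFFERENCE OF A COORDINATE PRODUCT** (`μ ≠ ν`):
`Π F((x+e_ν+e_μ)) − Π F((x+e_ν)) − Π F((x+e_μ)) + Π F(x) = (F_μ(x_μ+1) − F_μ(x_μ))·(F_ν(x_ν+1) − F_ν(x_ν))·Π_{α ≠ μ,ν} F_α(x_α)`. [folklore] -/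
theorem prod_coord_shift_shift_mixed (x : Site P 0) {μ ν : Fin P.d} (hμν : μ ≠ ν) :
    (∏ α, F α (((x.shift ν).shift μ) α)) - (∏ α, F α ((x.shift ν) α)) - (∏ α, F α ((x.shift μ) α)) + ∏ α, F α (x α) =
      (F μ (x μ + 1) - F μ (x μ)) * (F ν (x ν + 1) - F ν (x ν)) * ∏ α ∈ (Finset.univ.erase μ).erase ν, F α (x α) := by
  have hν : ν ∈ Finset.univ.erase μ := Finset.mem_erase.2 ⟨hμν.symm, Finset.mem_univ ν⟩
  have hmem : ∀ α ∈ (Finset.univ.erase μ).erase ν, α ≠ μ ∧ α ≠ ν := fun α hα =>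
    ⟨Finset.ne_of_mem_erase (Finset.mem_of_mem_erase hα), Finset.ne_of_mem_erase hα⟩
  have expand : ∀ z : Site P 0, ∏ α, F α (z α) = F μ (z μ) * (F ν (z ν) * ∏ α ∈ (Finset.univ.erase μ).erase ν, F α (z α)) := fun z => by
    rw [prod_coord_split F (Finset.mem_univ μ) z, prod_coord_split F hν z]
  rw [expand ((x.shift ν).shift μ), expand (x.shift ν), expand (x.shift μ), expand x, shift_apply_self, shift_apply_ne _ hμν.symm,
    shift_apply_self, shift_apply_ne _ hμν, shift_apply_self, shift_apply_ne _ hμν.symm,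
    prod_coord_congr F ((x.shift ν).shift μ) x fun α hα => by rw [shift_apply_ne _ (hmem α hα).1, shift_apply_ne _ (hmem α hα).2],
    prod_coord_congr F (x.shift ν) x fun α hα => by rw [shift_apply_ne _ (hmem α hα).2],
    prod_coord_congr F (x.shift μ) x fun α hα => by rw [shift_apply_ne _ (hmem α hα).1]]
  ring

/-- **PURE SECOND DIFFERENCE OF A COORDINATE PRODUCT**:
`Π F((x+2e_μ)) − 2Π F((x+e_μ)) + Π F(x) = (F_μ(x_μ+1+1) − 2F_μ(x_μ+1) + F_μ(x_μ))·Π_{α ≠ μ} F_α(x_α)`. [folklore] -/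
theorem prod_coord_shift_shift_pure (x : Site P 0) (μ : Fin P.d) :
    (∏ α, F α (((x.shift μ).shift μ) α)) - 2 * (∏ α, F α ((x.shift μ) α)) + ∏ α, F α (x α) =
      (F μ (x μ + 1 + 1) - 2 * F μ (x μ + 1) + F μ (x μ)) * ∏ α ∈ Finset.univ.erase μ, F α (x α) := by
  rw [prod_coord_split F (Finset.mem_univ μ) ((x.shift μ).shift μ), prod_coord_split F (Finset.mem_univ μ) (x.shift μ),
    prod_coord_split F (Finset.mem_univ μ) x, shift_apply_self, shift_apply_self,
    prod_coord_congr F ((x.shift μ).shift μ) x fun α hα => by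
      rw [shift_apply_ne _ (Finset.ne_of_mem_erase hα), shift_apply_ne _ (Finset.ne_of_mem_erase hα)],
    prod_coord_congr F (x.shift μ) x fun α hα => by rw [shift_apply_ne _ (Finset.ne_of_mem_erase hα)]]
  ring

end Prod

/-! ## §5 The smooth tent (bump) of a `j`-fold block -/

section Bump

/-- **SMOOTH TENTS (the bump of record, ★★OWNER g26 ASSIGNMENTS 9 (a))**: for every `j ≤ m + K` and `y ∈ T^{(j)}` there is `τ : T_η → [0, 1]` with `τ(embIter j y) = 1`, `τ = 0` off `B^j(y)`,
`|τ(b₊) − τ(b₋)| ≤ 8/L^j` on every fine bond, and the (mixed and pure) second differences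
`|τ(x + e_ν + e_μ) − τ(x + e_ν) − τ(x + e_μ) + τ(x)| ≤ 256/(L^j)²` for all `x, μ, ν` — the product over the coordinates of the quartic profiles
`((o+1)(L^j−o))²/(c+1)⁴` in the in-block labels `o`, `L^j = 2c+1`.  Replaces the linear tents of `exists_tent` wherever the GRADIENT row (46)₂ of the
bridge is needed. [cite: Balaban1984PropagatorsII, (2.147) p.248; Balaban1985Variational, (46) p.285] -/
theorem exists_smoothTent {j : ℕ} (hj : j ≤ P.m + P.K) (y : Site P j) :
    ∃ τ : Site P 0 → ℝ, τ (embIter j y) = 1 ∧ (∀ x, iterBlockOf j x ≠ y → τ x = 0) ∧ (∀ x, 0 ≤ τ x ∧ τ x ≤ 1) ∧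
      (∀ b : PBond P 0, |τ b.tgt - τ b.src| ≤ 8 / (P.L : ℝ) ^ j) ∧
      ∀ (x : Site P 0) (μ ν : Fin P.d), |τ ((x.shift ν).shift μ) - τ (x.shift ν) - τ (x.shift μ) + τ x| ≤ 256 / ((P.L : ℝ) ^ j) ^ 2 := by
  classical
  obtain ⟨c', hc'⟩ : Odd (P.L ^ j) := P.hL.1.pow
  set N : ℕ := P.L ^ j with hNdef
  set c : ℕ := (N - 1) / 2 with hcdef
  have hN : N = 2 * c + 1 := by omega
  have hNpos : 0 < N := by omega
  have hNreal : (P.L : ℝ) ^ j = (N : ℝ) := by rw [hNdef]; push_cast; rfl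
  have hNc : (N : ℝ) = 2 * c + 1 := bump1_cast hN
  have hc0 : (0 : ℝ) < (c : ℝ) + 1 := by positivity
  have hNS : N ∣ P.sitesPerDir 0 := BIJ88BlockCentredWeight.pow_dvd_sitesPerDir hj
  obtain ⟨g, hg⟩ : ∃ g : ℝ → ℝ, ∀ t, g t = ((t + 1) * ((N : ℝ) - t)) ^ 2 / ((c : ℝ) + 1) ^ 4 := ⟨_, fun _ => rfl⟩
  obtain ⟨G, hG⟩ : ∃ G : Fin P.d → ℕ → ℝ, ∀ α w, G α w = if w / N = (y α).val then g ((w % N : ℕ) : ℝ) else 0 := ⟨_, fun _ _ => rfl⟩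
  obtain ⟨F, hF⟩ : ∃ F : Fin P.d → ZMod (P.sitesPerDir 0) → ℝ, ∀ α v, F α v = G α v.val := ⟨_, fun _ _ => rfl⟩
  have hF01 : ∀ α v, 0 ≤ F α v ∧ F α v ≤ 1 := fun α v => bumpZ_mem_unit hN g hg (y α).val (G α) (hG α) (F α) (hF α) v
  have hFd : ∀ α v, |F α (v + 1) - F α v| ≤ 4 / ((c : ℝ) + 1) := fun α v => bumpZ_diff hN g hg (y α).val (G α) (hG α) hNS (F α) (hF α) v
  have hFdd : ∀ α v, |F α (v + 1 + 1) - 2 * F α (v + 1) + F α v| ≤ 64 / ((c : ℝ) + 1) ^ 2 := fun α v =>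
    bumpZ_diff2 hN g hg (y α).val (G α) (hG α) hNS (F α) (hF α) v
  have hR : ∀ (s : Finset (Fin P.d)) (x : Site P 0), 0 ≤ ∏ α ∈ s, F α (x α) ∧ ∏ α ∈ s, F α (x α) ≤ 1 := fun s x =>
    prod_mem_unit s _ fun α _ => hF01 α (x α)
  -- the constants in terms of `L^j = N = 2c + 1`
  have hconst1 : 4 / ((c : ℝ) + 1) ≤ 8 / (P.L : ℝ) ^ j := by
    rw [hNreal, div_le_div_iff₀ hc0 (by exact_mod_cast hNpos)]; nlinarith
  have hconst2 : 64 / ((c : ℝ) + 1) ^ 2 ≤ 256 / ((P.L : ℝ) ^ j) ^ 2 := by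
    rw [hNreal, div_le_div_iff₀ (by positivity) (by positivity)]; nlinarith [hc0]
  have hconst3 : (4 / ((c : ℝ) + 1)) * (4 / ((c : ℝ) + 1)) ≤ 256 / ((P.L : ℝ) ^ j) ^ 2 := by
    refine le_trans ?_ hconst2
    rw [div_mul_div_comm, div_le_div_iff₀ (by positivity) (by positivity)]; nlinarith [hc0]
  refine ⟨fun x => ∏ α, F α (x α), ?_, ?_, ?_, ?_, ?_⟩
  · -- the centre
    refine Finset.prod_eq_one fun α _ => ?_
    have hval : ((embIter j y) α).val = (y α).val * N + c := by rw [val_embIter j hj y α]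
    have hdiv : ((embIter j y) α).val / N = (y α).val := by
      rw [hval, Nat.mul_comm, Nat.mul_add_div hNpos, Nat.div_eq_of_lt (by omega : c < N), Nat.add_zero]
    have hmod : ((embIter j y) α).val % N = c := by
      rw [hval, Nat.mul_comm, Nat.mul_add_mod, Nat.mod_eq_of_lt (by omega : c < N)]
    rw [hF, hG, if_pos hdiv, hmod]
    exact bump1_centre hN g hg
  · -- the support
    intro x hx
    obtain ⟨α, hα⟩ : ∃ α, (iterBlockOf j x) α ≠ y α := Function.ne_iff.1 hx
    refine Finset.prod_eq_zero (Finset.mem_univ α) ?_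
    rw [hF, hG, if_neg]
    intro hdiv
    apply hα
    apply ZMod.val_injective
    rw [val_iterBlockOf j hj x α]
    exact hdiv
  · -- values in `[0, 1]`
    intro x; exact hR _ x
  · -- first differences
    intro b
    have hsub := prod_coord_shift_sub F b.src b.dir
    have htgt : b.tgt = b.src.shift b.dir := rfl
    rw [htgt, hsub, abs_mul]
    calc |F b.dir (b.src b.dir + 1) - F b.dir (b.src b.dir)| * |∏ α ∈ Finset.univ.erase b.dir, F α (b.src α)|
        ≤ 4 / ((c : ℝ) + 1) * 1 := by
          refine mul_le_mul (hFd _ _) ?_ (abs_nonneg _) (by positivity)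
          rw [abs_of_nonneg (hR _ _).1]; exact (hR _ _).2
      _ ≤ 8 / (P.L : ℝ) ^ j := by rw [mul_one]; exact hconst1
  · -- second differences
    intro x μ ν
    by_cases hμν : μ = ν
    · subst hμν
      have hpure := prod_coord_shift_shift_pure F x μ
      have : (∏ α, F α (((x.shift μ).shift μ) α)) - (∏ α, F α ((x.shift μ) α)) - (∏ α, F α ((x.shift μ) α)) + ∏ α, F α (x α) =
          (∏ α, F α (((x.shift μ).shift μ) α)) - 2 * (∏ α, F α ((x.shift μ) α)) + ∏ α, F α (x α) := by ring
      rw [this, hpure, abs_mul]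
      calc |F μ (x μ + 1 + 1) - 2 * F μ (x μ + 1) + F μ (x μ)| * |∏ α ∈ Finset.univ.erase μ, F α (x α)|
          ≤ 64 / ((c : ℝ) + 1) ^ 2 * 1 := by
            refine mul_le_mul (hFdd _ _) ?_ (abs_nonneg _) (by positivity)
            rw [abs_of_nonneg (hR _ _).1]; exact (hR _ _).2
        _ ≤ 256 / ((P.L : ℝ) ^ j) ^ 2 := by rw [mul_one]; exact hconst2
    · rw [prod_coord_shift_shift_mixed F x hμν, abs_mul, abs_mul]
      calc |F μ (x μ + 1) - F μ (x μ)| * |F ν (x ν + 1) - F ν (x ν)| * |∏ α ∈ (Finset.univ.erase μ).erase ν, F α (x α)|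
          ≤ (4 / ((c : ℝ) + 1)) * (4 / ((c : ℝ) + 1)) * 1 := by
            refine mul_le_mul (mul_le_mul (hFd _ _) (hFd _ _) (abs_nonneg _) (by positivity)) ?_ (abs_nonneg _) (by positivity)
            rw [abs_of_nonneg (hR _ _).1]; exact (hR _ _).2
        _ ≤ 256 / ((P.L : ℝ) ^ j) ^ 2 := by rw [mul_one]; exact hconst3

end Bump

end Summit.QuantumFields.YangMills.Theorems.ChartHInv

end
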